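import Literature.MathematicalPhysics.QuantumFieldTheory.Balaban1983to89.B11Rem289KernelColumnsCarrier

/-!
# `Balaban1983to89.B11Rem289KernelColumnsTheta3` — T. Bałaban, *The variational problem and background fields in renormalization group method for lattice
gauge theories*, Commun. Math. Phys. **102** (1985) 277–309 [Balaban1985Variational], the remark after Proposition 3, p. 289 («… an operator 𝔇₂(A′) for which we
have the bound (73) with ε₃² instead of ε₃»), (73) p. 289, (86) p. 291, Prop. 4 (97)–(98) pp. 292–293: **THE BINDER `hΘ3` OF `B11Eq98CurrentSlot.quadAnalytic_W80`
WITH A LETTER-ONLY CONSTANT, file 2∕2** — on `‖A′‖ < a_C`, `Σ_{b′}((Lʲ⁽ᵇ⁾η)³/(Lʲ⁽ᵇ′⁾η)³)‖k_{(HD₃)′(A′)}(b′, b)‖ ≤ ((2ℓ + 1)Θ_H^wG/a_C)·‖A′‖²`, `θ₃ = (2ℓ + 1)Θ_H^wG/a_C`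
(file 1 = `B11Rem289KernelColumnsCarrier`: Schwarz to second order, `(HD₃)′(0) = 0`, `(C⁽²⁾)′(Z) = D²C(0)(Z, ·)`, the column letters of `D²C(0)(Z, ·)` and `H(C⁽²⁾)′(Z)`)

statement-level skeleton of published theorems with citation tags; proofs where landed; nothing here is a claim about the Yang–Mills mass gap

PDF held: `paper:balaban1985-cmp102-variational-background` (journal page = PDF page + 276); p. 289 [PDF 13] through the verbatim quotations of file 1 and
`B11Rem289KernelConcrete`.

THE ARGUMENT (as in file 1's header).  For `0 < ‖A′‖ < a_C` the `ℓ¹`-vector `F(ζ)` of weighted kernel entries of `(HD₃)′(ζA′)`, `|ζ| < a_C/‖A′‖`, is holomorphic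
(`PiLp 1`; `HD₃` analytic), bounded by `(2ℓ + 1)Θ_H^wG·a_C` (§4), vanishes at `0` together with its derivative (`(HD₃)′(0) = 0`; per lattice the columns are
`O(‖·‖²)` near `0`, `B11Ineq73KernelLettersPerLattice.exists_theta3`, a qualitative input), so Schwarz to second order gives `‖F(1)‖ ≤ M(‖A′‖/a_C)²` (§5).

WHAT IS PROVED (sorry-free; no definition; letters displayed).
* §4 `kernel_sub`, `fderiv_E3_eq` (`(HD₃)′(Z) = (HD)′(Z) − H(C⁽²⁾)′(Z)`), **`colSum_weighted_kernel_fderiv_E3_le_linear`** (uniform on the ball: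
  `≤ (2ℓ + 1)Θ_H^wG·‖Z‖`, from `B11Eq73KernelColumnsCarrier.colSum_weighted_kernel_fderiv_Emap_le` and file 1 §3).
* §5 **`colSum_weighted_kernel_fderiv_E3_le`** — THE BINDER `hΘ3` with `θ₃ = (2ℓ + 1)Θ_H^wG/a_C`.
HONEST SCOPE.  (i) Mechanism on displayed letters (`hk`, `Θ_H`, `Θ_H^w` of `H`; `g`, `G` of `𝒞′`; the Sect. C regime); suppliers of this generation:
`B9Eq3126H1kPiOneBlockColumn` (H̃_{1,k}), `B11Eq44CKernelColumnTower` (C_k).  (ii) No decay used or claimed; constants crude.  (iii) NOT summit progress (cell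
pub-balaban: NE9 NOT PRINTED ∕ NOT PROVED; «NE9 ⇐ the named binders»; row WALLED ON A MODEL (O-NE9-1); spine PROVED 0∕9; rung (B)+1 on a finite T⁴ — NOT infinite
volume, NOT mass gap, NOT BetaPertH, NOT Clay; HONEST DEPENDENCY: continuum YM on T⁴ ⇐ BetaPertH ∧ nine spine estimates (0/9 proved); BetaPertH ⇐ (D1) ∧ (D4) ∧
CAP+tail; G-an2-4 gates asym, D1 and NE2/3/4).  Filed by the NE9 crux-team leaf seat `b2b-balaban-t4-ne9-formalise-leaf-01` (gen 97); NEW file; imports file 1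
ONLY; nothing modified.  Net new unproved facts: 0.
-/

noncomputable section

open scoped BigOperators
open Finset Metric Set Filter Topology

namespace Literature.MathematicalPhysics.QuantumFieldTheory.Balaban1983to89.B11Rem289KernelColumnsTheta3

open Literature.MathematicalPhysics.QuantumFieldTheory.Balaban1983to89.B11Prop6Scheme (Prop4Hyp)
open Literature.MathematicalPhysics.QuantumFieldTheory.Balaban1983to89.B11Eq174Chart (solA Regime)
open Literature.MathematicalPhysics.QuantumFieldTheory.Balaban1983to89.B11Eq90Transpose (kernel kernel_apply single115 sum_single115 flat115_single115)
open Literature.MathematicalPhysics.QuantumFieldTheory.Balaban1983to89.B11Eq90V0primeCurrent (flat115 flat115_apply)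
open Literature.MathematicalPhysics.QuantumFieldTheory.Balaban1983to89.B11Eq90V0GroupComposed (T47 T47_apply norm_T47_le norm_T47_lt fderiv_T47
  differentiableOn_solA)
open Literature.MathematicalPhysics.QuantumFieldTheory.Balaban1983to89.B11Eq80Current (Emap E3 quadPart Emap_eq_H Emap_eq analyticOnNhd_Emap analyticOnNhd_E3
  contDiff_quadPart)
open Literature.MathematicalPhysics.QuantumFieldTheory.Balaban1983to89.B11Ineq73KernelLettersPerLattice (exists_theta3)
open Literature.MathematicalPhysics.QuantumFieldTheory.Balaban1983to89.B11Eq73KernelColumnsCarrier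
open Literature.MathematicalPhysics.QuantumFieldTheory.Balaban1983to89.B11Rem289KernelColumnsCarrier
open B9SectCLatticeCarrier (Bond)
open B11Eq115Space

variable {𝔸 : Type*} [NormedRing 𝔸] [NormedAlgebra ℂ 𝔸] [FiniteDimensional ℂ 𝔸] [CompleteSpace 𝔸]
variable {d : ℕ} {Pd : Fin d → ℕ} {L η : ℝ} [Fact (0 < L)] [Fact (0 < η)] {lev₀ : Bond d Pd → ℕ} {κ' : Type*} [Fintype κ']
  {lev₁ : κ' → ℕ} {Dc : (Bond d Pd → 𝔸) →ₗ[ℂ] (κ' → 𝔸)}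
variable {β : Type*} [Fintype β] [DecidableEq β] {wB : β → ℝ} [Fact (∀ y, 0 < wB y)]
variable {H : NegSup wB 𝔸 →L[ℂ] Space115 L η lev₀ lev₁ Dc} {C : Space115 L η lev₀ lev₁ Dc → NegSup wB 𝔸} {b C₂ c₄ aC εC : ℝ}

/-! ## §4 The kernel of `(HD₃)′(Z)`: a uniform weighted column bound on the ball -/

section Uniform

variable (RC : Regime H 0 C b 0 C₂ c₄ 0 aC εC) (hC : Prop4Hyp C C₂ c₄) (haC : 0 < aC)
  {hk : Bond d Pd → β → ℝ} (hk0 : ∀ b' y, 0 ≤ hk b' y)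
  (hHk : ∀ (y : β) (Z : 𝔸) (b' : Bond d Pd), ‖flat115 (H ((NegSup.equiv wB 𝔸).symm (Pi.single y Z))) b'‖ ≤ hk b' y * ‖Z‖)
  {ΘH : ℝ} (hΘH : 0 ≤ ΘH) (hH1 : ∀ y, ∑ b', hk b' y ≤ ΘH) {ΘHw : ℝ} (hΘHw : 0 ≤ ΘHw)
  (hHw : ∀ (bb : Bond d Pd) (y : β), ∑ b', levWeight L η lev₀ 3 bb / levWeight L η lev₀ 3 b' * hk b' y ≤ ΘHw)
  {gC : β → Bond d Pd → ℝ} (hgC0 : ∀ y bb, 0 ≤ gC y bb)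
  (hCg : ∀ A : Space115 L η lev₀ lev₁ Dc, ‖A‖ < εC + aC → ∀ (bb : Bond d Pd) (X : 𝔸) (y : β),
      ‖NegSup.equiv wB 𝔸 (fderiv ℂ C A (single115 (lev₁ := lev₁) (Dc := Dc) bb X)) y‖ ≤ gC y bb * ‖A‖ * ‖X‖)
  {G : ℝ} (hG : ∀ bb, ∑ y, gC y bb ≤ G) (hq : (εC + aC) * ΘH * G ≤ 1 / 2)

omit [CompleteSpace 𝔸] [DecidableEq β] [Fact (∀ y, 0 < wB y)] in
/-- The kernel is linear in the operator: `k_{M − N} = k_M − k_N`. [cite: Balaban1985Variational, (63) p.287] -/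
theorem kernel_sub (M N : Space115 L η lev₀ lev₁ Dc →L[ℂ] Space115 L η lev₀ lev₁ Dc) (b' bb : Bond d Pd) :
    kernel (M - N) b' bb = kernel M b' bb - kernel N b' bb := by
  simp only [kernel, ContinuousLinearMap.sub_comp, ContinuousLinearMap.comp_sub]

omit [CompleteSpace 𝔸] [DecidableEq β] in
include RC hC in
/-- `(HD₃)′(Z) = (HD)′(Z) − H∘(C⁽²⁾)′(Z)` on `‖Z‖ < a_C`. [cite: Balaban1985Variational, (78) p.290, p.289] -/
theorem fderiv_E3_eq {Z : Space115 L η lev₀ lev₁ Dc} (hZ : ‖Z‖ < aC) :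
    fderiv ℂ (E3 H C εC) Z = fderiv ℂ (Emap H C εC) Z - H.comp (fderiv ℂ (quadPart C) Z) := by
  have hE : E3 H C εC = fun Y : Space115 L η lev₀ lev₁ Dc => Emap H C εC Y - H (quadPart C Y) := rfl
  have hEd : DifferentiableAt ℂ (Emap H C εC) Z := (analyticOnNhd_Emap RC hC Z (mem_ball_zero_iff.2 hZ)).differentiableAt
  have hqd : DifferentiableAt ℂ (quadPart C) Z := ((contDiff_quadPart C (n := 1)).differentiable one_ne_zero).differentiableAt
  have hHq : DifferentiableAt ℂ (fun Y => H (quadPart C Y)) Z := H.differentiableAt.comp _ hqd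
  have h2 : fderiv ℂ (fun Y => H (quadPart C Y)) Z = H.comp (fderiv ℂ (quadPart C) Z) := (H.hasFDerivAt.comp Z hqd.hasFDerivAt).fderiv
  rw [hE, fderiv_fun_sub hEd hHq, h2]

include RC hC haC hk0 hHk hΘH hH1 hΘHw hHw hgC0 hCg hG hq in
/-- **THE UNIFORM WEIGHTED COLUMN BOUND FOR THE KERNEL OF `(HD₃)′(Z)` ON THE BALL**: for `‖Z‖ < a_C`,
`Σ_{b′}((Lʲ⁽ᵇ⁾η)³/(Lʲ⁽ᵇ′⁾η)³)‖k_{(HD₃)′(Z)}(b′, b)‖ ≤ (2ℓ + 1)Θ_H^wG·‖Z‖` (`B11Eq73KernelColumnsCarrier`'s `θ_E`-bound for `(HD)′` plus §3 for `H(C⁽²⁾)′`).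
[cite: Balaban1985Variational, (73) p.289, (86) p.291] -/
theorem colSum_weighted_kernel_fderiv_E3_le_linear {Z : Space115 L η lev₀ lev₁ Dc} (hZ : ‖Z‖ < aC) (bb : Bond d Pd) :
    ∑ b', levWeight L η lev₀ 3 bb / levWeight L η lev₀ 3 b' * ‖kernel (fderiv ℂ (E3 H C εC) Z) b' bb‖ ≤
      (2 * (1 / (1 - 4 * b * C₂ * (εC + aC))) + 1) * ΘHw * G * ‖Z‖ := by
  have hw : ∀ b' : Bond d Pd, 0 < levWeight L η lev₀ 3 b' := levWeight_pos (Fact.out : 0 < L) (Fact.out : 0 < η) lev₀ 3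
  have h1 := colSum_weighted_kernel_fderiv_Emap_le RC hC hk0 hHk hH1 hgC0 hCg hG hq hΘH hΘHw hHw hZ bb
  have h2 : ∑ b', levWeight L η lev₀ 3 bb / levWeight L η lev₀ 3 b' * ‖kernel (H.comp (fderiv ℂ (quadPart C) Z)) b' bb‖ ≤ ΘHw * G * ‖Z‖ := by
    calc _ ≤ ∑ b', levWeight L η lev₀ 3 bb / levWeight L η lev₀ 3 b' * (‖Z‖ * ∑ y, hk b' y * gC y bb) :=
          Finset.sum_le_sum fun b' _ => mul_le_mul_of_nonneg_left (opNorm_kernel_H_fderiv_quadPart_le RC hC haC hk0 hHk hgC0 hCg Z b' bb)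
            (div_nonneg (hw bb).le (hw b').le)
      _ = ‖Z‖ * ∑ y, (∑ b', levWeight L η lev₀ 3 bb / levWeight L η lev₀ 3 b' * hk b' y) * gC y bb := by
          rw [Finset.mul_sum]
          simp only [Finset.mul_sum, Finset.sum_mul]
          rw [Finset.sum_comm]
          exact Finset.sum_congr rfl fun y _ => Finset.sum_congr rfl fun b' _ => by ring
      _ ≤ ‖Z‖ * ∑ y, ΘHw * gC y bb :=
          mul_le_mul_of_nonneg_left (Finset.sum_le_sum fun y _ => mul_le_mul_of_nonneg_right (hHw bb y) (hgC0 _ _)) (norm_nonneg _)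
      _ ≤ ‖Z‖ * (ΘHw * G) := by
          rw [← Finset.mul_sum]; exact mul_le_mul_of_nonneg_left (mul_le_mul_of_nonneg_left (hG bb) hΘHw) (norm_nonneg _)
      _ = ΘHw * G * ‖Z‖ := by ring
  have hsplit : ∀ b', ‖kernel (fderiv ℂ (E3 H C εC) Z) b' bb‖ ≤
      ‖kernel (fderiv ℂ (Emap H C εC) Z) b' bb‖ + ‖kernel (H.comp (fderiv ℂ (quadPart C) Z)) b' bb‖ := fun b' => by
    rw [fderiv_E3_eq RC hC hZ, kernel_sub]; exact norm_sub_le _ _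
  calc _ ≤ ∑ b', levWeight L η lev₀ 3 bb / levWeight L η lev₀ 3 b' *
          (‖kernel (fderiv ℂ (Emap H C εC) Z) b' bb‖ + ‖kernel (H.comp (fderiv ℂ (quadPart C) Z)) b' bb‖) :=
        Finset.sum_le_sum fun b' _ => mul_le_mul_of_nonneg_left (hsplit b') (div_nonneg (hw bb).le (hw b').le)
    _ = (∑ b', levWeight L η lev₀ 3 bb / levWeight L η lev₀ 3 b' * ‖kernel (fderiv ℂ (Emap H C εC) Z) b' bb‖) +
          ∑ b', levWeight L η lev₀ 3 bb / levWeight L η lev₀ 3 b' * ‖kernel (H.comp (fderiv ℂ (quadPart C) Z)) b' bb‖ := by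
        rw [← Finset.sum_add_distrib]
        exact Finset.sum_congr rfl fun b' _ => mul_add _ _ _
    _ ≤ 2 * ΘHw * G * (1 / (1 - 4 * b * C₂ * (εC + aC))) * ‖Z‖ + ΘHw * G * ‖Z‖ := add_le_add h1 h2
    _ = _ := by ring

/-! ## §5 «(73) with ε₃² instead of ε₃»: the weighted columns of the kernel of `(HD₃)′(A′)` are `O(‖A′‖²)`, lattice-free -/

include RC hC haC hk0 hHk hΘH hH1 hΘHw hHw hgC0 hCg hG hq in
/-- **THE BINDER `hΘ3` WITH A LETTER-ONLY CONSTANT** — «If we subtract these terms from 𝔇(A′), then we get an operator 𝔇₂(A′) for which we have the bound (73)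
with ε₃² instead of ε₃»: on `‖A′‖ < a_C`, `Σ_{b′}((Lʲ⁽ᵇ⁾η)³/(Lʲ⁽ᵇ′⁾η)³)‖k_{(HD₃)′(A′)}(b′, b)‖ ≤ ((2ℓ + 1)Θ_H^wG/a_C)·‖A′‖²` — Schwarz to second order (§1)
along the radial line `ζ ↦ ζA′` for the `ℓ¹`-vector of weighted kernel entries (uniform bound §4 on `|ζ| < a_C/‖A′‖`; value and derivative at `ζ = 0`
vanish: `(HD₃)′(0) = 0`, and per lattice the columns are `O(‖·‖²)` near `0`, `B11Ineq73KernelLettersPerLattice.exists_theta3`).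
[cite: Balaban1985Variational, p.289 (after Prop. 3), (73) p.289, (86) p.291] -/
theorem colSum_weighted_kernel_fderiv_E3_le {A' : Space115 L η lev₀ lev₁ Dc} (hA' : ‖A'‖ < aC) (bb : Bond d Pd) :
    ∑ b', levWeight L η lev₀ 3 bb / levWeight L η lev₀ 3 b' * ‖kernel (fderiv ℂ (E3 H C εC) A') b' bb‖ ≤
      ((2 * (1 / (1 - 4 * b * C₂ * (εC + aC))) + 1) * ΘHw * G / aC) * ‖A'‖ ^ 2 := by
  have hw : ∀ b' : Bond d Pd, 0 < levWeight L η lev₀ 3 b' := levWeight_pos (Fact.out : 0 < L) (Fact.out : 0 < η) lev₀ 3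
  set r : Bond d Pd → ℝ := fun b' => levWeight L η lev₀ 3 bb / levWeight L η lev₀ 3 b' with hr
  have hr0 : ∀ b', 0 ≤ r b' := fun b' => div_nonneg (hw bb).le (hw b').le
  have hG0 : 0 ≤ G := (Finset.sum_nonneg fun y _ => hgC0 y bb).trans (hG bb)
  have h1q : 0 < 1 - 4 * b * C₂ * (εC + aC) := by linarith [RC.contr]
  have hℓ : 0 < 1 / (1 - 4 * b * C₂ * (εC + aC)) := by positivity
  set Mslope : ℝ := (2 * (1 / (1 - 4 * b * C₂ * (εC + aC))) + 1) * ΘHw * G with hMs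
  have hMs0 : 0 ≤ Mslope := by rw [hMs]; positivity
  rcases eq_or_ne A' 0 with rfl | hA0
  · simp [fderiv_E3_zero RC hC haC, kernel]
  have hnA : 0 < ‖A'‖ := norm_pos_iff.2 hA0
  set R₁ : ℝ := aC / ‖A'‖ with hR₁def
  have hR₁ : 1 < R₁ := by rw [hR₁def, lt_div_iff₀ hnA, one_mul]; exact hA'
  have hR₁0 : 0 < R₁ := by linarith
  -- the radial line stays in the ball
  have hline : ∀ ζ : ℂ, ζ ∈ ball (0 : ℂ) R₁ → ‖ζ • A'‖ < aC := by
    intro ζ hζ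
    rw [mem_ball_zero_iff] at hζ
    rw [norm_smul]
    calc ‖ζ‖ * ‖A'‖ < R₁ * ‖A'‖ := mul_lt_mul_of_pos_right hζ hnA
      _ = aC := by rw [hR₁def, div_mul_cancel₀ _ hnA.ne']
  -- the `ℓ¹`-vector of weighted kernel entries along the line
  set F : ℂ → PiLp 1 (fun _ : Bond d Pd => 𝔸 →L[ℂ] 𝔸) :=
    fun ζ => WithLp.toLp 1 (fun b' => ((r b' : ℝ) : ℂ) • kernel (fderiv ℂ (E3 H C εC) (ζ • A')) b' bb) with hF
  have hFnorm : ∀ ζ : ℂ, ‖F ζ‖ = ∑ b', r b' * ‖kernel (fderiv ℂ (E3 H C εC) (ζ • A')) b' bb‖ := by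
    intro ζ
    rw [hF, PiLp.norm_eq_of_L1]
    refine Finset.sum_congr rfl fun b' _ => ?_
    rw [PiLp.toLp_apply, norm_smul, Complex.norm_real, Real.norm_of_nonneg (hr0 b')]
  -- holomorphy on the disc
  have hE3an : AnalyticOnNhd ℂ (fderiv ℂ (E3 H C εC)) (ball (0 : Space115 L η lev₀ lev₁ Dc) aC) := (analyticOnNhd_E3 RC hC).fderiv
  have hFd : DifferentiableOn ℂ F (ball (0 : ℂ) R₁) := by
    refine (differentiableOn_piLp 1).2 fun b' ζ hζ => ?_
    have hT : DifferentiableAt ℂ (fun ζ : ℂ => fderiv ℂ (E3 H C εC) (ζ • A')) ζ :=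
      (hE3an (ζ • A') (mem_ball_zero_iff.2 (hline ζ hζ))).differentiableAt.comp ζ (differentiableAt_id.smul_const A')
    have h : DifferentiableAt ℂ (fun ζ : ℂ => ((r b' : ℝ) : ℂ) •
        ((JetSup.evalCLM (levWeight L η lev₀ 1) (levWeight L η lev₁ 2) Dc b').comp
          ((fderiv ℂ (E3 H C εC) (ζ • A')).comp (single115 (lev₁ := lev₁) (Dc := Dc) bb)))) ζ :=
      ((differentiableAt_const _).clm_comp (hT.clm_comp (differentiableAt_const _))).fun_const_smul _
    exact h.differentiableWithinAt
  have hF0 : F 0 = 0 := by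
    have hk : ∀ b', kernel (fderiv ℂ (E3 H C εC) ((0 : ℂ) • A')) b' bb = 0 := fun b' => by
      rw [zero_smul, fderiv_E3_zero RC hC haC]; simp [kernel]
    have h0 : ‖F 0‖ = 0 := by
      rw [hFnorm]
      exact Finset.sum_eq_zero fun b' _ => by rw [hk, norm_zero, mul_zero]
    exact norm_eq_zero.1 h0
  -- the columns are `O(|ζ|²)` near `0` (per lattice), hence `F′(0) = 0`
  have hF1 : deriv F 0 = 0 := by
    obtain ⟨R₃, hR₃, -, h3⟩ := exists_theta3 RC hC haC
    obtain ⟨θ₃', -, hΘ3'⟩ := h3 (R₃ / 2) (half_pos hR₃) (half_lt_self hR₃)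
    have hFda : DifferentiableAt ℂ F 0 := hFd.differentiableAt (isOpen_ball.mem_nhds (mem_ball_self hR₁0))
    refine deriv_eq_zero_of_norm_le_sq hFda.hasDerivAt hF0 (c := θ₃' * ‖A'‖ ^ 2) (ρ := R₃ / 2 / ‖A'‖) (by positivity) fun t ht => ?_
    have htA : ‖t • A'‖ < R₃ / 2 := by
      rw [norm_smul]; rwa [lt_div_iff₀ hnA] at ht
    rw [hFnorm]
    calc _ ≤ θ₃' * ‖t • A'‖ ^ 2 := hΘ3' _ htA bb
      _ = θ₃' * ‖A'‖ ^ 2 * ‖t‖ ^ 2 := by rw [norm_smul]; ring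
  -- the uniform bound on the disc
  have hFb : ∀ ζ ∈ ball (0 : ℂ) R₁, ‖F ζ‖ ≤ Mslope * aC := fun ζ hζ => by
    rw [hFnorm]
    exact (colSum_weighted_kernel_fderiv_E3_le_linear RC hC haC hk0 hHk hΘH hH1 hΘHw hHw hgC0 hCg hG hq (hline ζ hζ) bb).trans
      (mul_le_mul_of_nonneg_left (hline ζ hζ).le hMs0)
  -- Schwarz to second order at `ζ = 1`
  have h1mem : (1 : ℂ) ∈ ball (0 : ℂ) R₁ := by simpa using hR₁
  have key := norm_le_mul_sq_div_of_zero_of_deriv_zero hR₁0 hFd hF0 hF1 hFb h1mem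
  rw [hFnorm, one_smul, norm_one] at key
  refine key.trans (le_of_eq ?_)
  rw [hR₁def]
  field_simp

end Uniform

end Literature.MathematicalPhysics.QuantumFieldTheory.Balaban1983to89.B11Rem289KernelColumnsTheta3

end
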